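import Literature.Computability.AlgebraicComplexity.PartitionedTensors
import Literature.Computability.AlgebraicComplexity.FixingHolesShuffle
import Mathlib.Data.Nat.Log
import HarnessLib

/-!
# Fixing holes (Vassilevska Williams–Xu–Xu–Zhou 2024, Thm. 7.2) — proved

Topic `Literature/Computability/AlgebraicComplexity`.  §7 of Vassilevska Williams–Xu–Xu–Zhou,
*New bounds for matrix multiplication: from alpha to omega* (SODA 2024, arXiv:2307.07970):

> **Theorem 7.2.** Let `T` be a partitioned tensor; let `T_1, …, T_r` be broken copies of `T`, where
> in each `T_i` at most a `1/(4 log M_X)`, `1/(4 log M_Y)`, `1/(4 log M_Z)` fraction of `X`-, `Y`-,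
> `Z`-parts are holes. If `T` satisfies Property 7.1 with a set of permutations `𝒢`, then there is a
> constant `C_0` such that for `r ≥ C_0 · M^{3/log log N}`, `M = max{M_X, M_Y, M_Z}`, we have
> `⊕_{i=1}^r T_i ⊵ T`.  In particular, `M^{o(1)}` broken copies of `T` with fraction of holes
> `O(1/log M)` can degenerate into an unbroken copy of `T`.

(Cor. 4.2, fixing holes in interface tensors, applies it with the level-1 blocks as parts.)  This
file PROVES the theorem in the following explicit form (`vxxz2024_thm72`), in the block calculus of
`PartitionedTensors.lean` (parts `pX : X → 𝒫_X`, …; broken copy with holes `H` =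
`partSubtensor pX pY pZ T Hᶜ Hᶜ Hᶜ`; direct sum `familyDirectSum`; symmetries as in Property 7.1 with
the uniformity counting hypothesis of `FixingHolesShuffle.vxxz2024_lemma73`):

* for any integers `L_X, L_Y, L_Z ≥ 2` (the paper: `L_W = log M_W`), if every broken copy has at
  most `M_W / (4 L_W)` holes among the `M_W = |𝒫_W|` parts in each dimension `W`, then the direct sum
  of any `r ≥ 8^{⌊log_{L_X} M_X⌋ + ⌊log_{L_Y} M_Y⌋ + ⌊log_{L_Z} M_Z⌋ + 3}` such broken copies RESTRICTS to
  `T` (restriction `TensorRestrictsTo`, a special degeneration: the printed proof uses only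
  relabellings, zero-outs and the identification of disjoint copies of variables).

With `L_W = ⌊log₂ M_W⌋` this is `8^{3 + Σ_W log M_W / log log M_W} = M^{O(1/log log M)}` copies, the
printed `C_0 M^{3/log log N}` up to the constant in the exponent (the printed solution of the
recursion, `7^{1+Σ⌈log_{log M_W} M_W⌉}`, likewise gives `M^{3 log 7/ log log M}`).

## Proof (as printed, made explicit)

Induction on the remaining "budget" `n = Σ_W (D_W − k_W)`, `D_W = ⌊log_{L_W} M_W⌋ + 1`, for the claim:
for sets of parts `A, B, C` with `L_X^{k_X} |A| ≤ M_X`, …, the direct sum of ANY `8^n` admissible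
broken copies restricts to `T‖_{A,B,C}` (`fixHoles_aux`).  If a budget is exhausted the set is empty
and `T‖ = 0`.  Otherwise split the `8^{m+1}` copies into `8` blocks of `8^m` (an equivalence
`{0,1}³ × [8^m] ≃ [8^{m+1}]`, `familyDirectSum_reindex` + `familyDirectSum_prod`); let `c₀` be the first
copy of the block of the cell `(1,1,1)`, with holes `H_X, H_Y, H_Z`; Lemma 7.3
(`vxxz2024_lemma73_mul`) gives a symmetry `γ` with `|A ∩ π_X^γ(H_X)| · M_X ≤ 4 |A| |H_X|`, so
`A⁰ := A ∩ π_X^γ(H_X)` has `L_X |A⁰| ≤ |A|` (hole bound), and likewise `B⁰`, `C⁰`; put `A¹ := A ∖ A⁰`.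
The cell `(1,1,1)`: its block projects to the copy `c₀` (`familyDirectSum_apply_le`), which relabelled
by `γ` is the broken copy with holes `π^γ(H)` (`partSubtensor_relabel`), which zeroes out to
`T‖_{A¹,B¹,C¹}` since `A¹ ∩ π_X^γ(H_X) = ∅` (`partSubtensor_mono`).  Every other cell has at least one
coordinate of budget `k_W + 1` (`L_W^{k_W+1} |W⁰| ≤ M_W`) and is produced from its own block by the
induction hypothesis.  The eight cells glue to `T‖_{A,B,C}` (`familyDirectSum_cells_le`).  Finally
`A = 𝒫_X, B = 𝒫_Y, C = 𝒫_Z`, `k = 0` (`vxxz2024_thm72`).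

## References

* V. Vassilevska Williams, Y. Xu, Z. Xu, R. Zhou, *New bounds for matrix multiplication: from alpha
  to omega*, SODA 2024, arXiv:2307.07970, §7: Property 7.1, Thm. 7.2 and its proof, Lemma 7.3;
  §4.2 Cor. 4.2. [VassilevskaWilliamsXuXuZhou2024]
-/

open scoped BigOperators
open Finset

namespace Literature.Computability.AlgebraicComplexity

universe u

section FixingHoles

variable {K : Type u} [CommSemiring K]
variable {X Y Z PX PY PZ Γ : Type*} [Fintype X] [Fintype Y] [Fintype Z] [DecidableEq X]
  [DecidableEq Y] [DecidableEq Z] [Fintype PX] [Fintype PY] [Fintype PZ] [DecidableEq PX]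
  [DecidableEq PY] [DecidableEq PZ] [Fintype Γ] [Nonempty Γ]

/-- Budget bookkeeping: if `L^k · s ≤ M < L^D` and `D ≤ k` then `s = 0`. [folklore] -/
private theorem eq_zero_of_pow_mul_le {L M k D s : ℕ} (hL : 1 ≤ L) (hM : M < L ^ D) (hD : D ≤ k)
    (h : L ^ k * s ≤ M) : s = 0 := by
  by_contra hs
  have h1 : L ^ D ≤ L ^ k := Nat.pow_le_pow_right hL hD
  have h2 : L ^ k ≤ L ^ k * s := Nat.le_mul_of_pos_right _ (Nat.pos_of_ne_zero hs)
  exact absurd (hM.trans_le (h1.trans (h2.trans h))) (lt_irrefl _)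

/-- From Lemma 7.3's bound and the hole budget: `|A ∩ π(H)| · M ≤ 4 |A| |H|` and `4 L |H| ≤ M`
with `M > 0` give `L · |A ∩ π(H)| ≤ |A|`. [folklore] -/
private theorem mul_card_le_of_shuffle {L M a a0 h : ℕ} (hM : 0 < M) (h1 : a0 * M ≤ 4 * (a * h))
    (h2 : 4 * L * h ≤ M) : L * a0 ≤ a := by
  refine Nat.le_of_mul_le_mul_right ?_ hM
  calc L * a0 * M = L * (a0 * M) := by ring
    _ ≤ L * (4 * (a * h)) := Nat.mul_le_mul_left _ h1
    _ = a * (4 * L * h) := by ring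
    _ ≤ a * M := Nat.mul_le_mul_left _ h2

/-- **The recursion of the proof of Thm. 7.2** (see the module docstring): with budgets
`L_X^{k_X} |A| ≤ M_X`, `L_Y^{k_Y} |B| ≤ M_Y`, `L_Z^{k_Z} |C| ≤ M_Z` and remaining budget
`Σ_W (⌊log_{L_W} M_W⌋ + 1 − k_W) ≤ n`, the direct sum of any `8^n` broken copies of `T` with at most
`M_W/(4 L_W)` holes per dimension restricts to `T‖_{A,B,C}`.
[cite: VassilevskaWilliamsXuXuZhou2024, Thm. 7.2 (proof)] -/
theorem fixHoles_aux (pX : X → PX) (pY : Y → PY) (pZ : Z → PZ) (T : X → Y → Z → K)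
    (σX : Γ → Equiv.Perm X) (σY : Γ → Equiv.Perm Y) (σZ : Γ → Equiv.Perm Z)
    (πX : Γ → Equiv.Perm PX) (πY : Γ → Equiv.Perm PY) (πZ : Γ → Equiv.Perm PZ)
    (hpX : ∀ γ x, pX (σX γ x) = πX γ (pX x)) (hpY : ∀ γ y, pY (σY γ y) = πY γ (pY y))
    (hpZ : ∀ γ z, pZ (σZ γ z) = πZ γ (pZ z))
    (hT : ∀ γ x y z, T (σX γ x) (σY γ y) (σZ γ z) = T x y z)
    (hX : ∀ t t' : PX, (univ.filter fun γ => πX γ t = t').card * Fintype.card PX = Fintype.card Γ)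
    (hY : ∀ t t' : PY, (univ.filter fun γ => πY γ t = t').card * Fintype.card PY = Fintype.card Γ)
    (hZ : ∀ t t' : PZ, (univ.filter fun γ => πZ γ t = t').card * Fintype.card PZ = Fintype.card Γ)
    {LX LY LZ : ℕ} (hLX : 2 ≤ LX) (hLY : 2 ≤ LY) (hLZ : 2 ≤ LZ) (n : ℕ) :
    ∀ (kX kY kZ : ℕ) (A : Finset PX) (B : Finset PY) (C : Finset PZ),
      (Nat.log LX (Fintype.card PX) + 1 - kX) + (Nat.log LY (Fintype.card PY) + 1 - kY) +
          (Nat.log LZ (Fintype.card PZ) + 1 - kZ) ≤ n →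
      LX ^ kX * A.card ≤ Fintype.card PX → LY ^ kY * B.card ≤ Fintype.card PY →
      LZ ^ kZ * C.card ≤ Fintype.card PZ →
      ∀ (HX : Fin (8 ^ n) → Finset PX) (HY : Fin (8 ^ n) → Finset PY)
        (HZ : Fin (8 ^ n) → Finset PZ),
        (∀ i, 4 * LX * (HX i).card ≤ Fintype.card PX) →
        (∀ i, 4 * LY * (HY i).card ≤ Fintype.card PY) →
        (∀ i, 4 * LZ * (HZ i).card ≤ Fintype.card PZ) →
        TensorRestrictsTo
          (familyDirectSum fun i => partSubtensor pX pY pZ T (HX i)ᶜ (HY i)ᶜ (HZ i)ᶜ)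
          (partSubtensor pX pY pZ T A B C) := by
  have hLX1 : 1 ≤ LX := by omega
  have hLY1 : 1 ≤ LY := by omega
  have hLZ1 : 1 ≤ LZ := by omega
  have hMX : Fintype.card PX < LX ^ (Nat.log LX (Fintype.card PX) + 1) :=
    Nat.lt_pow_succ_log_self (by omega) _
  have hMY : Fintype.card PY < LY ^ (Nat.log LY (Fintype.card PY) + 1) :=
    Nat.lt_pow_succ_log_self (by omega) _
  have hMZ : Fintype.card PZ < LZ ^ (Nat.log LZ (Fintype.card PZ) + 1) :=
    Nat.lt_pow_succ_log_self (by omega) _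
  induction n with
  | zero =>
    intro kX kY kZ A B C hrem hA hB hC HX HY HZ hHX hHY hHZ
    have hkX : Nat.log LX (Fintype.card PX) + 1 ≤ kX := by omega
    have hA0 : A = ∅ := Finset.card_eq_zero.1 (eq_zero_of_pow_mul_le hLX1 hMX hkX hA)
    rw [hA0, partSubtensor_empty_left]
    exact TensorRestrictsTo.zero _
  | succ m ih =>
    intro kX kY kZ A B C hrem hA hB hC HX HY HZ hHX hHY hHZ
    -- exhausted budgets / empty targets
    by_cases hAe : A = ∅
    · rw [hAe, partSubtensor_empty_left]; exact TensorRestrictsTo.zero _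
    by_cases hBe : B = ∅
    · rw [hBe, partSubtensor_empty_mid]; exact TensorRestrictsTo.zero _
    by_cases hCe : C = ∅
    · rw [hCe, partSubtensor_empty_right]; exact TensorRestrictsTo.zero _
    have hApos : 0 < A.card := Finset.card_pos.2 (Finset.nonempty_iff_ne_empty.2 hAe)
    have hBpos : 0 < B.card := Finset.card_pos.2 (Finset.nonempty_iff_ne_empty.2 hBe)
    have hCpos : 0 < C.card := Finset.card_pos.2 (Finset.nonempty_iff_ne_empty.2 hCe)
    have hMXpos : 0 < Fintype.card PX := hApos.trans_le (card_le_univ A)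
    have hMYpos : 0 < Fintype.card PY := hBpos.trans_le (card_le_univ B)
    have hMZpos : 0 < Fintype.card PZ := hCpos.trans_le (card_le_univ C)
    have hkX : kX < Nat.log LX (Fintype.card PX) + 1 := by
      by_contra h
      exact hApos.ne' (eq_zero_of_pow_mul_le hLX1 hMX (not_lt.1 h) hA)
    have hkY : kY < Nat.log LY (Fintype.card PY) + 1 := by
      by_contra h
      exact hBpos.ne' (eq_zero_of_pow_mul_le hLY1 hMY (not_lt.1 h) hB)
    have hkZ : kZ < Nat.log LZ (Fintype.card PZ) + 1 := by
      by_contra h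
      exact hCpos.ne' (eq_zero_of_pow_mul_le hLZ1 hMZ (not_lt.1 h) hC)
    -- split the `8^{m+1}` copies into `8` blocks of `8^m`
    have hcard : Fintype.card ((Bool × Bool × Bool) × Fin (8 ^ m)) =
        Fintype.card (Fin (8 ^ (m + 1))) := by
      simp only [Fintype.card_prod, Fintype.card_bool, Fintype.card_fin, pow_succ]
      ring
    let e : (Bool × Bool × Bool) × Fin (8 ^ m) ≃ Fin (8 ^ (m + 1)) := Fintype.equivOfCardEq hcard
    have hNpos : 0 < 8 ^ m := pow_pos (by norm_num) m
    -- the distinguished copy `c₀` of the block of the cell `(1,1,1)` and the symmetry `γ`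
    set c₀ : Fin (8 ^ (m + 1)) := e ((true, true, true), ⟨0, hNpos⟩) with hc₀
    obtain ⟨γ, hγX, hγY, hγZ⟩ :=
      vxxz2024_lemma73_mul πX πY πZ hX hY hZ A (HX c₀) B (HY c₀) C (HZ c₀)
    -- the cells
    set A0 : Finset PX := A ∩ (HX c₀).image (πX γ) with hA0def
    set B0 : Finset PY := B ∩ (HY c₀).image (πY γ) with hB0def
    set C0 : Finset PZ := C ∩ (HZ c₀).image (πZ γ) with hC0def
    have hA0le : LX * A0.card ≤ A.card := mul_card_le_of_shuffle hMXpos hγX (hHX c₀)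
    have hB0le : LY * B0.card ≤ B.card := mul_card_le_of_shuffle hMYpos hγY (hHY c₀)
    have hC0le : LZ * C0.card ≤ C.card := mul_card_le_of_shuffle hMZpos hγZ (hHZ c₀)
    have hA0 : LX ^ (kX + 1) * A0.card ≤ Fintype.card PX :=
      calc LX ^ (kX + 1) * A0.card = LX ^ kX * (LX * A0.card) := by rw [pow_succ]; ring
        _ ≤ LX ^ kX * A.card := Nat.mul_le_mul_left _ hA0le
        _ ≤ Fintype.card PX := hA
    have hB0 : LY ^ (kY + 1) * B0.card ≤ Fintype.card PY :=
      calc LY ^ (kY + 1) * B0.card = LY ^ kY * (LY * B0.card) := by rw [pow_succ]; ring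
        _ ≤ LY ^ kY * B.card := Nat.mul_le_mul_left _ hB0le
        _ ≤ Fintype.card PY := hB
    have hC0 : LZ ^ (kZ + 1) * C0.card ≤ Fintype.card PZ :=
      calc LZ ^ (kZ + 1) * C0.card = LZ ^ kZ * (LZ * C0.card) := by rw [pow_succ]; ring
        _ ≤ LZ ^ kZ * C.card := Nat.mul_le_mul_left _ hC0le
        _ ≤ Fintype.card PZ := hC
    have hA1 : LX ^ kX * (A \ A0).card ≤ Fintype.card PX :=
      (Nat.mul_le_mul_left _ (card_le_card sdiff_subset)).trans hA
    have hB1 : LY ^ kY * (B \ B0).card ≤ Fintype.card PY :=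
      (Nat.mul_le_mul_left _ (card_le_card sdiff_subset)).trans hB
    have hC1 : LZ ^ kZ * (C \ C0).card ≤ Fintype.card PZ :=
      (Nat.mul_le_mul_left _ (card_le_card sdiff_subset)).trans hC
    let cellA : Bool → Finset PX := fun b => cond b (A \ A0) A0
    let cellB : Bool → Finset PY := fun b => cond b (B \ B0) B0
    let cellC : Bool → Finset PZ := fun b => cond b (C \ C0) C0
    -- each cell is produced by its block of copies
    have hcell : ∀ j : Bool × Bool × Bool,
        TensorRestrictsTo
          (familyDirectSum fun i : Fin (8 ^ m) =>
            partSubtensor pX pY pZ T (HX (e (j, i)))ᶜ (HY (e (j, i)))ᶜ (HZ (e (j, i)))ᶜ)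
          (partSubtensor pX pY pZ T (cellA j.1) (cellB j.2.1) (cellC j.2.2)) := by
      rintro ⟨a, b, c⟩
      cases a <;> cases b <;> cases c
      -- seven recursive cells (at least one coordinate hit), budgets `k` or `k + 1`
      · exact ih (kX + 1) (kY + 1) (kZ + 1) A0 B0 C0 (by omega) hA0 hB0 hC0 _ _ _
          (fun i => hHX _) (fun i => hHY _) (fun i => hHZ _)
      · exact ih (kX + 1) (kY + 1) kZ A0 B0 (C \ C0) (by omega) hA0 hB0 hC1 _ _ _
          (fun i => hHX _) (fun i => hHY _) (fun i => hHZ _)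
      · exact ih (kX + 1) kY (kZ + 1) A0 (B \ B0) C0 (by omega) hA0 hB1 hC0 _ _ _
          (fun i => hHX _) (fun i => hHY _) (fun i => hHZ _)
      · exact ih (kX + 1) kY kZ A0 (B \ B0) (C \ C0) (by omega) hA0 hB1 hC1 _ _ _
          (fun i => hHX _) (fun i => hHY _) (fun i => hHZ _)
      · exact ih kX (kY + 1) (kZ + 1) (A \ A0) B0 C0 (by omega) hA1 hB0 hC0 _ _ _
          (fun i => hHX _) (fun i => hHY _) (fun i => hHZ _)
      · exact ih kX (kY + 1) kZ (A \ A0) B0 (C \ C0) (by omega) hA1 hB0 hC1 _ _ _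
          (fun i => hHX _) (fun i => hHY _) (fun i => hHZ _)
      · exact ih kX kY (kZ + 1) (A \ A0) (B \ B0) C0 (by omega) hA1 hB1 hC0 _ _ _
          (fun i => hHX _) (fun i => hHY _) (fun i => hHZ _)
      · -- the cell `(1,1,1)`: one copy, relabelled by `γ` and zeroed out
        have h0 : TensorRestrictsTo
            (familyDirectSum fun i : Fin (8 ^ m) =>
              partSubtensor pX pY pZ T (HX (e ((true, true, true), i)))ᶜ
                (HY (e ((true, true, true), i)))ᶜ (HZ (e ((true, true, true), i)))ᶜ)
            (partSubtensor pX pY pZ T (HX c₀)ᶜ (HY c₀)ᶜ (HZ c₀)ᶜ) :=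
          familyDirectSum_apply_le
            (fun i : Fin (8 ^ m) =>
              partSubtensor pX pY pZ T (HX (e ((true, true, true), i)))ᶜ
                (HY (e ((true, true, true), i)))ᶜ (HZ (e ((true, true, true), i)))ᶜ) ⟨0, hNpos⟩
        have h1 := partSubtensor_relabel pX pY pZ T (σX γ) (σY γ) (σZ γ) (πX γ) (πY γ) (πZ γ)
          (hpX γ) (hpY γ) (hpZ γ) (hT γ) (HX c₀)ᶜ (HY c₀)ᶜ (HZ c₀)ᶜ
        rw [image_compl_perm, image_compl_perm, image_compl_perm] at h1
        have hsubA : A \ A0 ⊆ ((HX c₀).image (πX γ))ᶜ := fun x hx => by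
          rw [mem_compl]
          exact fun hx' => (mem_sdiff.1 hx).2 (mem_inter.2 ⟨(mem_sdiff.1 hx).1, hx'⟩)
        have hsubB : B \ B0 ⊆ ((HY c₀).image (πY γ))ᶜ := fun y hy => by
          rw [mem_compl]
          exact fun hy' => (mem_sdiff.1 hy).2 (mem_inter.2 ⟨(mem_sdiff.1 hy).1, hy'⟩)
        have hsubC : C \ C0 ⊆ ((HZ c₀).image (πZ γ))ᶜ := fun z hz => by
          rw [mem_compl]
          exact fun hz' => (mem_sdiff.1 hz).2 (mem_inter.2 ⟨(mem_sdiff.1 hz).1, hz'⟩)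
        have h2 := partSubtensor_mono pX pY pZ T hsubA hsubB hsubC
        exact h0.trans (h1.trans h2)
    -- assemble
    have step1 := familyDirectSum_reindex
      (fun i : Fin (8 ^ (m + 1)) => partSubtensor pX pY pZ T (HX i)ᶜ (HY i)ᶜ (HZ i)ᶜ) e.injective
    have step2 := familyDirectSum_prod (fun (j : Bool × Bool × Bool) (i : Fin (8 ^ m)) =>
      partSubtensor pX pY pZ T (HX (e (j, i)))ᶜ (HY (e (j, i)))ᶜ (HZ (e (j, i)))ᶜ)
    have step3 := familyDirectSum_mono hcell
    have step4 := familyDirectSum_cells_le pX pY pZ T cellA cellB cellC disjoint_sdiff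
      disjoint_sdiff disjoint_sdiff
    have hUA : cellA false ∪ cellA true = A := union_sdiff_of_subset inter_subset_left
    have hUB : cellB false ∪ cellB true = B := union_sdiff_of_subset inter_subset_left
    have hUC : cellC false ∪ cellC true = C := union_sdiff_of_subset inter_subset_left
    rw [hUA, hUB, hUC] at step4
    exact step1.trans (step2.trans (step3.trans step4))

/-- **VXXZ 2024, Theorem 7.2 (fixing holes), explicit form.**  Let `T` be a partitioned tensor
(`pX, pY, pZ` the part maps, `M_W = |𝒫_W|` parts in dimension `W`) carrying a nonempty finite family
`γ ↦ (σ_X^γ, σ_Y^γ, σ_Z^γ)` of symmetries as in Property 7.1: each `σ_W^γ` permutes the variables,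
maps parts to parts (inducing `π_W^γ` on `𝒫_W`), the triple preserves `T`, and the induced family is
uniform (`#{γ | π_W^γ(t) = t'} · M_W = |𝒢|` for all parts `t, t'`).  Let `L_X, L_Y, L_Z ≥ 2` and let
`T_1, …, T_r` be broken copies of `T` (holes `H_W(i) ⊆ 𝒫_W`) with at most `M_W/(4 L_W)` holes in
each dimension, `4 L_W |H_W(i)| ≤ M_W`.  If `r ≥ 8^{⌊log_{L_X} M_X⌋ + ⌊log_{L_Y} M_Y⌋ + ⌊log_{L_Z} M_Z⌋ + 3}`
then `⊕_{i=1}^r T_i ≥ T` — the direct sum of the broken copies RESTRICTS to (in particular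
degenerates into) an unbroken copy of `T`.  (Printed: hole fractions `≤ 1/(4 log M_W)` and
`r ≥ C_0 M^{3/log log N}`; with `L_W = ⌊log₂ M_W⌋` the present count is `M^{O(1/log log M)}`, see
the module docstring.) [cite: VassilevskaWilliamsXuXuZhou2024, Thm. 7.2] -/
theorem vxxz2024_thm72 (pX : X → PX) (pY : Y → PY) (pZ : Z → PZ) (T : X → Y → Z → K)
    (σX : Γ → Equiv.Perm X) (σY : Γ → Equiv.Perm Y) (σZ : Γ → Equiv.Perm Z)
    (πX : Γ → Equiv.Perm PX) (πY : Γ → Equiv.Perm PY) (πZ : Γ → Equiv.Perm PZ)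
    (hpX : ∀ γ x, pX (σX γ x) = πX γ (pX x)) (hpY : ∀ γ y, pY (σY γ y) = πY γ (pY y))
    (hpZ : ∀ γ z, pZ (σZ γ z) = πZ γ (pZ z))
    (hT : ∀ γ x y z, T (σX γ x) (σY γ y) (σZ γ z) = T x y z)
    (hX : ∀ t t' : PX, (univ.filter fun γ => πX γ t = t').card * Fintype.card PX = Fintype.card Γ)
    (hY : ∀ t t' : PY, (univ.filter fun γ => πY γ t = t').card * Fintype.card PY = Fintype.card Γ)
    (hZ : ∀ t t' : PZ, (univ.filter fun γ => πZ γ t = t').card * Fintype.card PZ = Fintype.card Γ)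
    {LX LY LZ : ℕ} (hLX : 2 ≤ LX) (hLY : 2 ≤ LY) (hLZ : 2 ≤ LZ)
    {r : ℕ} (HX : Fin r → Finset PX) (HY : Fin r → Finset PY) (HZ : Fin r → Finset PZ)
    (hHX : ∀ i, 4 * LX * (HX i).card ≤ Fintype.card PX)
    (hHY : ∀ i, 4 * LY * (HY i).card ≤ Fintype.card PY)
    (hHZ : ∀ i, 4 * LZ * (HZ i).card ≤ Fintype.card PZ)
    (hr : 8 ^ (Nat.log LX (Fintype.card PX) + Nat.log LY (Fintype.card PY) +
      Nat.log LZ (Fintype.card PZ) + 3) ≤ r) :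
    TensorRestrictsTo (familyDirectSum fun i => partSubtensor pX pY pZ T (HX i)ᶜ (HY i)ᶜ (HZ i)ᶜ)
      T := by
  set n := Nat.log LX (Fintype.card PX) + Nat.log LY (Fintype.card PY) +
    Nat.log LZ (Fintype.card PZ) + 3 with hn
  -- keep the first `8^n` copies
  have step0 := familyDirectSum_reindex
    (fun i : Fin r => partSubtensor pX pY pZ T (HX i)ᶜ (HY i)ᶜ (HZ i)ᶜ) (Fin.castLE_injective hr)
  have h := fixHoles_aux pX pY pZ T σX σY σZ πX πY πZ hpX hpY hpZ hT hX hY hZ hLX hLY hLZ n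
    0 0 0 univ univ univ (by omega) (by simp) (by simp) (by simp)
    (fun i => HX (Fin.castLE hr i)) (fun i => HY (Fin.castLE hr i)) (fun i => HZ (Fin.castLE hr i))
    (fun i => hHX _) (fun i => hHY _) (fun i => hHZ _)
  rw [partSubtensor_univ] at h
  exact step0.trans h

end FixingHoles

end Literature.Computability.AlgebraicComplexity
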